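import Summits.QuantumFields.BalabanUV.Beta.GAN24.CombChargeTowerStepZero
import Summits.QuantumFields.BalabanUV.Beta.GAN24.PairFormPeriodTowerBase
import Summits.QuantumFields.BalabanUV.Beta.GAN24.ForcingCellPairFormLevelZero

/-!
# `BalabanUV.Beta.GAN24.CrossedLedgerFirstStep` — binder row G-an2-4 ∕ (CONV-C), W-slot (α-0), ROW (C)sym, register PART VI row **T6-VAL**: **THE FIRST STEP OF THE
# CROSSED LEDGER, HYPOTHESIS-FREE** — the comb member's crossed cell value at LEVEL `1` in closed form, and **`X(zmode_Lc U_1) = X(zmode_Lc U_0) ⟺ c = (8M²)⁻¹`**: the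
# crossed conservation from level `0` to level `1` holds EXACTLY at the END probes' normalisation of the Wilson quartic, where both values are `2·Lc¹²`
# (G-an2-4 CRUX TEAM (2), leaf prover 03 `b2b-balaban-gan24-formalise-leaf-03`, gen 72; journal [LEAF03-G72-INTENT3])

NOT IN PRINT; OUR BOOKKEEPING ([folklore] three TREE theorems BY NAME + `field_simp ∕ ring ∕ linear_combination`: road-P2 g50's top row `CombChargeTowerStepZero.
legBondSym_zmode_succ_eq_fourFace` at `j = 0`, `N = Lc` (four-face currency), leaf-06 g55's level-`0` forcing number `ForcingCellPairFormLevelZero.crossed_zmode_forcing_level0_pin`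
(`X(zmode_Lc b̃_0)(a,b) = −2·Lc¹²·(Lc² − 1)` at `cE = Lc⁴`, `cE₂ = Lc⁸`), the OWNER gan24-p1's base values `PairFormPeriodTowerBase.crossed_faceRead_memberZero` (`P⁴·X(FF_P U_0) =
16M²cE₂c·P⁶`) and `crossed_zmode_memberZero` (`X(zmode_{N₀} U_0) = 16M²cE₂c·N₀⁴`); 0 `def`, 0 cited fact, 0 `def … : Prop`, 0 sorry).  HONEST FRAMING (cell contract, verbatim):
«discharging `BetaPertH` makes Bałaban's UV stability UNCONDITIONAL — a real constructive-QFT result; it is NOT the continuum limit and NOT the Clay problem.»  HONEST DEPENDENCY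
(verbatim): «continuum YM on T⁴ ⇐ BetaPertH ∧ nine spine estimates (0/9 proved); BetaPertH ⇐ (D1) ∧ (D4) ∧ CAP+tail; G-an2-4 gates asym, D1 and NE2/3/4.»

WHY.  Row T6-VAL is the crossed conservation `hX : X(zmode_Lc U_{l+2})(a,b) = X(zmode_Lc U_{l+1})(a,b)` of the comb member's leg-and-bond symmetrised cell charge along the levels
`≥ 1` (`X(Y)(a,b) := Y abab + Y baab + (Y abba + Y baba)`, `U_i := unitS₂_i T̃_i`); `CrossedLedgerClosure` ∕ `CrossedLedgerForcingWilson` (this lineage, gen 72) make it ONE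
cumulative identity per anti-diagonal of the E-frame forcing's crossed values, with the constant `X(zmode_Lc U_1)(a,b) = X(zmode_Lc b̃_0)(a,b) + (Lc⁴∕2)·32M²cE₂c·Lc²`.  THIS FILE
evaluates that constant from the tree and compares it with level `0`: by the top row at `j = 0` (coefficient `2·Lc⁴·cE₂Lc⁸·½·Lc⁻²⁰ = 1` at `N = Lc`, `cE₂ = Lc⁸`),
`X(zmode_Lc U_1) = X(zmode_Lc b̃_0) + Lc⁴·X(FF_{Lc} U_0)·(bond-symmetrised) = −2·Lc¹²·(Lc² − 1) + 16·M²·c·Lc¹⁴`, while `X(zmode_Lc U_0) = 16·M²·c·Lc¹²`; the two agree iff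
`(16M²c − 2)·Lc¹²·(Lc² − 1) = 0`, i.e. (for `Lc ≥ 2`, `M ≠ 0`) iff `c = (8M²)⁻¹` — the END probes' pin (`EndOfTowerProbe2`: `Tc = (8N²)⁻¹ • wsym22 N`), at which both values
are `2·Lc¹²`.  So the crossed ledger's FIRST step (level `0 → 1`, outside `hX`'s range `l+1 → l+2`) HOLDS in the tree with no hypothesis, and it is what FIXES the Wilson quartic's
normalisation against the E-frame forcing: any other `c` breaks crossed conservation already at the first step.  A consistency check of the whole two-index tower's currency
(road-P2's `2λ̂ = 1`, g55's level-`0` number, the OWNER's base rows) — weight: three tree theorems composed; it says NOTHING about the levels `≥ 1` of `hX`.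

WHAT ([folklore]; `d = 3`, `1 ≤ Lc`, in-block root `r ∈ box 4 Lc`, pins `cE = Lc⁴`, `cE₂ = Lc⁸`; `cVH cΛ cB` free; Wilson quartic `Tc = c • wsym22 M` with `c`, `M` FREE; jointly
`Lc`-covariant `LocStencil₂` border `vh₂S` with zero ff ∕ mm blocks; ordered pair `a ≠ b`):
* **`crossed_zmode_memberOne`**: `X(zmode_Lc U_1)(a,b) = −2·Lc¹²·(Lc² − 1) + 16·M²·c·Lc¹⁴`;
* **`crossed_zmode_memberOne_sub_memberZero`**: `X(zmode_Lc U_1)(a,b) − X(zmode_Lc U_0)(a,b) = (16·M²·c − 2)·Lc¹²·(Lc² − 1)`;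
* **`crossed_zmode_memberOne_eq_memberZero_iff`** (`2 ≤ Lc`, `M ≠ 0`): `X(zmode_Lc U_1)(a,b) = X(zmode_Lc U_0)(a,b) ⟺ c = (8·M²)⁻¹`;
* **`crossed_zmode_memberOne_pin`** (`c = (8·M²)⁻¹`, `M ≠ 0`): `X(zmode_Lc U_1)(a,b) = 2·Lc¹²` (`= X(zmode_Lc U_0)(a,b)`, **`crossed_zmode_memberOne_eq_memberZero_pin`**;
  primed twin with the level spelled `1` instead of `0 + 1`).
Asserts NO value of Bałaban's tables beyond the three tree theorems it composes; discharges NOTHING of `hX` ∕ `hXu` ∕ `hSrcX` ∕ (C)_{≥1} ∕ `hB0` ∕ `hBF` ∕ (Q-L) ∕ (hW, hWall);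
NEVER «G-an2-4 closed» as (CONV-C); NOT D1, NOT `BetaPertH`, NOT continuum, NOT Clay.  2026-08-24; no existing file touched.
-/

noncomputable section

open Finset
open scoped BigOperators
open Literature.MathematicalPhysics.QuantumFieldTheory
open Literature.MathematicalPhysics.QuantumFieldTheory.Balaban1983to89
open Literature.MathematicalPhysics.QuantumFieldTheory.Balaban1983to89.Beta
open ExpKernelCalculus (Site MKer shiftK)
open OneStepKernelFamily (KInvStep)
open BalabanCompositeJets (LocStencil₂)
open SecondOrderResponse (W2SymOfK)
open BalabanStepJetsSucc (mmRead)
open BalabanStepW2 (K3OfK M2Of)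
open WilsonVertex2Sym (wsym22)
open AffineAveraging (box toSite)
open AveragingMixedJetTables (mixFFAt)
open Summit.QuantumFields.BalabanUV.Beta.AxialDressingRooted (coDressKBmAt)
open Summit.QuantumFields.BalabanUV.Beta.HessKerDressedUnits (unitK unitS)
open Summit.QuantumFields.BalabanUV.Beta.SecondOrderUnits (unitM unitS₂ unitM₂)
open Summit.QuantumFields.BalabanUV.Beta.SpineRooted (T2RecAt SpureRecAt M1At)
open Summit.QuantumFields.BalabanUV.Beta.GAN24.CombesThomas (sfStep smStep)
open Summit.QuantumFields.BalabanUV.Beta.GAN24.BiStencilZeroMode (Tab zmode)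
open Summit.QuantumFields.BalabanUV.Beta.GAN24.CombChargeTowerStepZero (legBondSym_zmode_succ_eq_fourFace)
open Summit.QuantumFields.BalabanUV.Beta.GAN24.PairFormPeriodTowerBase (crossed_faceRead_memberZero crossed_zmode_memberZero)
open Summit.QuantumFields.BalabanUV.Beta.GAN24.ForcingCellPairFormLevelZero (crossed_zmode_forcing_level0_pin)

namespace Summit.QuantumFields.BalabanUV.Beta.GAN24.CrossedLedgerFirstStep

variable {Lc : ℕ} [NeZero Lc] {r : Fin (3 + 1) → ℕ}

/-- NOT IN PRINT; OUR BOOKKEEPING.  **THE COMB MEMBER's CROSSED CELL VALUE AT LEVEL `1` IN CLOSED FORM** (module docstring): road-P2's top row at `j = 0`, `N = Lc`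
(coefficient exactly `1` at `cE₂ = Lc⁸`) splits `X(zmode_Lc U_1)` into the level-`0` forcing's crossed cell value — leaf-06 g55's `−2·Lc¹²·(Lc² − 1)` — and `Lc⁴`× the
OWNER's bond-symmetrised base face value `2·16M²cE₂c·Lc²` at `P = Lc`: `X(zmode_Lc U_1)(a,b) = −2·Lc¹²·(Lc² − 1) + 16·M²·c·Lc¹⁴`. -/
theorem crossed_zmode_memberOne (hLc : 1 ≤ Lc) (hr : r ∈ box (3 + 1) Lc) {cE cE₂ : ℝ} (cVH cΛ cB : ℝ) (c : ℝ) (M : ℕ)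
    (hcE : cE = (Lc : ℝ) ^ (3 + 1)) (hcE₂ : cE₂ = (Lc : ℝ) ^ (2 * (3 + 1)))
    {vh₂S : Tab 3} (hBff : ∀ κ u κ' u' x z (α β : Fin (3 + 1)), vh₂S κ u κ' u' x z (Sum.inl α) (Sum.inl β) = 0)
    (hBmm : ∀ κ u κ' u' x z (μ ν : Fin (3 + 1)), vh₂S κ u κ' u' x z (Sum.inr μ) (Sum.inr ν) = 0)
    (hB : ∃ C δ : ℝ, 0 < δ ∧ LocStencil₂ vh₂S C δ)
    (hBt : ∀ (κ : Fin (3 + 1)) (u : Fin (3 + 1) → ℤ) (κ' : Fin (3 + 1)) (u' t : Fin (3 + 1) → ℤ),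
      vh₂S κ (u + (Lc : ℤ) • t) κ' (u' + (Lc : ℤ) • t) = shiftK (-((Lc : ℤ) • t)) (vh₂S κ u κ' u'))
    {a b : Fin (3 + 1)} (hab : a ≠ b) :
    zmode Lc (unitS₂ (sfStep Lc (0 + 1)) (smStep 3 Lc (0 + 1)) (T2RecAt 3 Lc (toSite r) cE cVH cΛ cE₂ cB (c • wsym22 M) vh₂S (mixFFAt (toSite r) Lc) (0 + 1))) a b (Sum.inl a) (Sum.inl b) + zmode Lc (unitS₂ (sfStep Lc (0 + 1)) (smStep 3 Lc (0 + 1)) (T2RecAt 3 Lc (toSite r) cE cVH cΛ cE₂ cB (c • wsym22 M) vh₂S (mixFFAt (toSite r) Lc) (0 + 1))) b a (Sum.inl a) (Sum.inl b) + (zmode Lc (unitS₂ (sfStep Lc (0 + 1)) (smStep 3 Lc (0 + 1)) (T2RecAt 3 Lc (toSite r) cE cVH cΛ cE₂ cB (c • wsym22 M) vh₂S (mixFFAt (toSite r) Lc) (0 + 1))) a b (Sum.inl b) (Sum.inl a) + zmode Lc (unitS₂ (sfStep Lc (0 + 1)) (smStep 3 Lc (0 + 1)) (T2RecAt 3 Lc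 (toSite r) cE cVH cΛ cE₂ cB (c • wsym22 M) vh₂S (mixFFAt (toSite r) Lc) (0 + 1))) b a (Sum.inl b) (Sum.inl a))
      = -2 * (Lc : ℝ) ^ 12 * ((Lc : ℝ) ^ 2 - 1) + 16 * (M : ℝ) ^ 2 * c * (Lc : ℝ) ^ 14 := by
  have hL : (Lc : ℝ) ≠ 0 := Nat.cast_ne_zero.mpr (NeZero.ne Lc)
  have htop := legBondSym_zmode_succ_eq_fourFace (d := 3) hLc hr cE cVH cΛ cE₂ cB (c • wsym22 M) hBff hBmm hB hBt Lc 0 a b a b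
  have hB0 := crossed_zmode_forcing_level0_pin hLc hr cVH cΛ cB hcE hcE₂ hBff hab
  have hF0 := crossed_faceRead_memberZero (Lc := Lc) (P := Lc) hLc cE cVH cΛ cE₂ cB c M (toSite r) (mixFF := mixFFAt (toSite r) Lc) hBff hab
  have hlam : 2 * ((((Lc : ℕ) : ℝ) ^ (3 + 1)) * ((cE₂ * (Lc : ℝ) ^ (2 * (3 + 1))) * ((1 / 2 : ℝ) * (((Lc : ℝ) ^ (3 + 1 + 1))⁻¹) ^ 4))) = 1 := by
    rw [hcE₂]; field_simp; ring
  rw [htop, hB0, hlam, one_mul]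
  have e : (16 : ℝ) * (M : ℝ) ^ 2 * c * (Lc : ℝ) ^ 14 = 16 * (M : ℝ) ^ 2 * cE₂ * c * ((Lc : ℕ) : ℝ) ^ 6 := by
    rw [hcE₂]; ring
  rw [e, ← hF0]

/-- NOT IN PRINT; OUR BOOKKEEPING.  **LEVEL `1` MINUS LEVEL `0`**: with the OWNER's `X(zmode_Lc U_0)(a,b) = 16M²cE₂c·Lc⁴ = 16·M²·c·Lc¹²`,
`X(zmode_Lc U_1)(a,b) − X(zmode_Lc U_0)(a,b) = (16·M²·c − 2)·Lc¹²·(Lc² − 1)`. -/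
theorem crossed_zmode_memberOne_sub_memberZero (hLc : 1 ≤ Lc) (hr : r ∈ box (3 + 1) Lc) {cE cE₂ : ℝ} (cVH cΛ cB : ℝ) (c : ℝ) (M : ℕ)
    (hcE : cE = (Lc : ℝ) ^ (3 + 1)) (hcE₂ : cE₂ = (Lc : ℝ) ^ (2 * (3 + 1)))
    {vh₂S : Tab 3} (hBff : ∀ κ u κ' u' x z (α β : Fin (3 + 1)), vh₂S κ u κ' u' x z (Sum.inl α) (Sum.inl β) = 0)
    (hBmm : ∀ κ u κ' u' x z (μ ν : Fin (3 + 1)), vh₂S κ u κ' u' x z (Sum.inr μ) (Sum.inr ν) = 0)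
    (hB : ∃ C δ : ℝ, 0 < δ ∧ LocStencil₂ vh₂S C δ)
    (hBt : ∀ (κ : Fin (3 + 1)) (u : Fin (3 + 1) → ℤ) (κ' : Fin (3 + 1)) (u' t : Fin (3 + 1) → ℤ),
      vh₂S κ (u + (Lc : ℤ) • t) κ' (u' + (Lc : ℤ) • t) = shiftK (-((Lc : ℤ) • t)) (vh₂S κ u κ' u'))
    {a b : Fin (3 + 1)} (hab : a ≠ b) :
    (zmode Lc (unitS₂ (sfStep Lc (0 + 1)) (smStep 3 Lc (0 + 1)) (T2RecAt 3 Lc (toSite r) cE cVH cΛ cE₂ cB (c • wsym22 M) vh₂S (mixFFAt (toSite r) Lc) (0 + 1))) a b (Sum.inl a) (Sum.inl b) + zmode Lc (unitS₂ (sfStep Lc (0 + 1)) (smStep 3 Lc (0 + 1)) (T2RecAt 3 Lc (toSite r) cE cVH cΛ cE₂ cB (c • wsym22 M) vh₂S (mixFFAt (toSite r) Lc) (0 + 1))) b a (Sum.inl a) (Sum.inl b) + (zmode Lc (unitS₂ (sfStep Lc (0 + 1)) (smStep 3 Lc (0 + 1)) (T2RecAt 3 Lc (toSite r) cE cVH cΛ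 cE₂ cB (c • wsym22 M) vh₂S (mixFFAt (toSite r) Lc) (0 + 1))) a b (Sum.inl b) (Sum.inl a) + zmode Lc (unitS₂ (sfStep Lc (0 + 1)) (smStep 3 Lc (0 + 1)) (T2RecAt 3 Lc (toSite r) cE cVH cΛ cE₂ cB (c • wsym22 M) vh₂S (mixFFAt (toSite r) Lc) (0 + 1))) b a (Sum.inl b) (Sum.inl a)))
      - (zmode Lc (unitS₂ (sfStep Lc 0) (smStep 3 Lc 0) (T2RecAt 3 Lc (toSite r) cE cVH cΛ cE₂ cB (c • wsym22 M) vh₂S (mixFFAt (toSite r) Lc) 0)) a b (Sum.inl a) (Sum.inl b) + zmode Lc (unitS₂ (sfStep Lc 0) (smStep 3 Lc 0) (T2RecAt 3 Lc (toSite r) cE cVH cΛ cE₂ cB (c • wsym22 M) vh₂S (mixFFAt (toSite r) Lc) 0)) b a (Sum.inl a) (Sum.inl b) + (zmode Lc (unitS₂ (sfStep Lc 0) (smStep 3 Lc 0) (T2RecAt 3 Lc (toSite r) cE cVH cΛ cE₂ cB (c • wsym22 M) vh₂S (mixFFAt (toSite r) Lc) 0)) a b (Sum.inl b) (Sum.inl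 a) + zmode Lc (unitS₂ (sfStep Lc 0) (smStep 3 Lc 0) (T2RecAt 3 Lc (toSite r) cE cVH cΛ cE₂ cB (c • wsym22 M) vh₂S (mixFFAt (toSite r) Lc) 0)) b a (Sum.inl b) (Sum.inl a)))
      = (16 * (M : ℝ) ^ 2 * c - 2) * (Lc : ℝ) ^ 12 * ((Lc : ℝ) ^ 2 - 1) := by
  rw [crossed_zmode_memberOne hLc hr cVH cΛ cB c M hcE hcE₂ hBff hBmm hB hBt hab,
    crossed_zmode_memberZero (Lc := Lc) Lc cE cVH cΛ cE₂ cB c M (toSite r) (mixFF := mixFFAt (toSite r) Lc) hBff hab, hcE₂]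
  push_cast
  ring

/-- NOT IN PRINT; OUR BOOKKEEPING.  **THE FIRST STEP OF THE CROSSED LEDGER HOLDS EXACTLY AT THE END PROBES' NORMALISATION** (`2 ≤ Lc`, `M ≠ 0`): the comb member's
crossed cell value is conserved from level `0` to level `1` IF AND ONLY IF the Wilson quartic's coefficient is `c = (8M²)⁻¹`. -/
theorem crossed_zmode_memberOne_eq_memberZero_iff (hLc : 1 ≤ Lc) (hr : r ∈ box (3 + 1) Lc) {cE cE₂ : ℝ} (cVH cΛ cB : ℝ) (c : ℝ) (M : ℕ)
    (hcE : cE = (Lc : ℝ) ^ (3 + 1)) (hcE₂ : cE₂ = (Lc : ℝ) ^ (2 * (3 + 1)))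
    {vh₂S : Tab 3} (hBff : ∀ κ u κ' u' x z (α β : Fin (3 + 1)), vh₂S κ u κ' u' x z (Sum.inl α) (Sum.inl β) = 0)
    (hBmm : ∀ κ u κ' u' x z (μ ν : Fin (3 + 1)), vh₂S κ u κ' u' x z (Sum.inr μ) (Sum.inr ν) = 0)
    (hB : ∃ C δ : ℝ, 0 < δ ∧ LocStencil₂ vh₂S C δ)
    (hBt : ∀ (κ : Fin (3 + 1)) (u : Fin (3 + 1) → ℤ) (κ' : Fin (3 + 1)) (u' t : Fin (3 + 1) → ℤ),
      vh₂S κ (u + (Lc : ℤ) • t) κ' (u' + (Lc : ℤ) • t) = shiftK (-((Lc : ℤ) • t)) (vh₂S κ u κ' u'))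
    {a b : Fin (3 + 1)} (hab : a ≠ b) (hLc2 : 2 ≤ Lc) (hM : M ≠ 0) :
    zmode Lc (unitS₂ (sfStep Lc (0 + 1)) (smStep 3 Lc (0 + 1)) (T2RecAt 3 Lc (toSite r) cE cVH cΛ cE₂ cB (c • wsym22 M) vh₂S (mixFFAt (toSite r) Lc) (0 + 1))) a b (Sum.inl a) (Sum.inl b) + zmode Lc (unitS₂ (sfStep Lc (0 + 1)) (smStep 3 Lc (0 + 1)) (T2RecAt 3 Lc (toSite r) cE cVH cΛ cE₂ cB (c • wsym22 M) vh₂S (mixFFAt (toSite r) Lc) (0 + 1))) b a (Sum.inl a) (Sum.inl b) + (zmode Lc (unitS₂ (sfStep Lc (0 + 1)) (smStep 3 Lc (0 + 1)) (T2RecAt 3 Lc (toSite r) cE cVH cΛ cE₂ cB (c • wsym22 M) vh₂S (mixFFAt (toSite r) Lc) (0 + 1))) a b (Sum.inl b) (Sum.inl a) + zmode Lc (unitS₂ (sfStep Lc (0 + 1)) (smStep 3 Lc (0 + 1)) (T2RecAt 3 Lc (toSite r) cE cVH cΛ cE₂ cB (c • wsym22 M) vh₂S (mixFFAt (toSite r)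 Lc) (0 + 1))) b a (Sum.inl b) (Sum.inl a))
      = zmode Lc (unitS₂ (sfStep Lc 0) (smStep 3 Lc 0) (T2RecAt 3 Lc (toSite r) cE cVH cΛ cE₂ cB (c • wsym22 M) vh₂S (mixFFAt (toSite r) Lc) 0)) a b (Sum.inl a) (Sum.inl b) + zmode Lc (unitS₂ (sfStep Lc 0) (smStep 3 Lc 0) (T2RecAt 3 Lc (toSite r) cE cVH cΛ cE₂ cB (c • wsym22 M) vh₂S (mixFFAt (toSite r) Lc) 0)) b a (Sum.inl a) (Sum.inl b) + (zmode Lc (unitS₂ (sfStep Lc 0) (smStep 3 Lc 0) (T2RecAt 3 Lc (toSite r) cE cVH cΛ cE₂ cB (c • wsym22 M) vh₂S (mixFFAt (toSite r) Lc) 0)) a b (Sum.inl b) (Sum.inl a) + zmode Lc (unitS₂ (sfStep Lc 0) (smStep 3 Lc 0) (T2RecAt 3 Lc (toSite r) cE cVH cΛ cE₂ cB (c • wsym22 M) vh₂S (mixFFAt (toSite r) Lc) 0)) b a (Sum.inl b) (Sum.inl a))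
    ↔ c = (8 * (M : ℝ) ^ 2)⁻¹ := by
  have hsub := crossed_zmode_memberOne_sub_memberZero hLc hr cVH cΛ cB c M hcE hcE₂ hBff hBmm hB hBt hab
  have hL : (Lc : ℝ) ≠ 0 := Nat.cast_ne_zero.mpr (NeZero.ne Lc)
  have hMr : (M : ℝ) ≠ 0 := Nat.cast_ne_zero.mpr hM
  have hM2 : (8 : ℝ) * (M : ℝ) ^ 2 ≠ 0 := by positivity
  have hL2 : (Lc : ℝ) ^ 2 - 1 ≠ 0 := by
    have h2 : (2 : ℝ) ≤ (Lc : ℝ) := by exact_mod_cast hLc2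
    nlinarith
  have hL12 : (Lc : ℝ) ^ 12 ≠ 0 := pow_ne_zero 12 hL
  constructor
  · intro h
    have h0 : (16 * (M : ℝ) ^ 2 * c - 2) * (Lc : ℝ) ^ 12 * ((Lc : ℝ) ^ 2 - 1) = 0 := by
      rw [← hsub]; linear_combination h
    have h1 : 16 * (M : ℝ) ^ 2 * c - 2 = 0 := by
      rcases mul_eq_zero.mp h0 with h01 | h02
      · rcases mul_eq_zero.mp h01 with h011 | h012
        · exact h011
        · exact absurd h012 hL12
      · exact absurd h02 hL2
    exact eq_inv_of_mul_eq_one_left (by linear_combination (1 / 2 : ℝ) * h1)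
  · intro hc
    have h1 : 16 * (M : ℝ) ^ 2 * c - 2 = 0 := by
      rw [hc]; field_simp; ring
    have h2 := hsub
    rw [h1, zero_mul, zero_mul] at h2
    linear_combination h2

/-- NOT IN PRINT; OUR BOOKKEEPING.  **AT THE PIN `c = (8M²)⁻¹` THE LEVEL-`1` VALUE IS `2·Lc¹²`** (`M ≠ 0`). -/
theorem crossed_zmode_memberOne_pin (hLc : 1 ≤ Lc) (hr : r ∈ box (3 + 1) Lc) {cE cE₂ : ℝ} (cVH cΛ cB : ℝ) (c : ℝ) (M : ℕ)
    (hcE : cE = (Lc : ℝ) ^ (3 + 1)) (hcE₂ : cE₂ = (Lc : ℝ) ^ (2 * (3 + 1)))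
    {vh₂S : Tab 3} (hBff : ∀ κ u κ' u' x z (α β : Fin (3 + 1)), vh₂S κ u κ' u' x z (Sum.inl α) (Sum.inl β) = 0)
    (hBmm : ∀ κ u κ' u' x z (μ ν : Fin (3 + 1)), vh₂S κ u κ' u' x z (Sum.inr μ) (Sum.inr ν) = 0)
    (hB : ∃ C δ : ℝ, 0 < δ ∧ LocStencil₂ vh₂S C δ)
    (hBt : ∀ (κ : Fin (3 + 1)) (u : Fin (3 + 1) → ℤ) (κ' : Fin (3 + 1)) (u' t : Fin (3 + 1) → ℤ),
      vh₂S κ (u + (Lc : ℤ) • t) κ' (u' + (Lc : ℤ) • t) = shiftK (-((Lc : ℤ) • t)) (vh₂S κ u κ' u'))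
    {a b : Fin (3 + 1)} (hab : a ≠ b) (hM : M ≠ 0) (hc : c = (8 * (M : ℝ) ^ 2)⁻¹) :
    zmode Lc (unitS₂ (sfStep Lc (0 + 1)) (smStep 3 Lc (0 + 1)) (T2RecAt 3 Lc (toSite r) cE cVH cΛ cE₂ cB (c • wsym22 M) vh₂S (mixFFAt (toSite r) Lc) (0 + 1))) a b (Sum.inl a) (Sum.inl b) + zmode Lc (unitS₂ (sfStep Lc (0 + 1)) (smStep 3 Lc (0 + 1)) (T2RecAt 3 Lc (toSite r) cE cVH cΛ cE₂ cB (c • wsym22 M) vh₂S (mixFFAt (toSite r) Lc) (0 + 1))) b a (Sum.inl a) (Sum.inl b) + (zmode Lc (unitS₂ (sfStep Lc (0 + 1)) (smStep 3 Lc (0 + 1)) (T2RecAt 3 Lc (toSite r) cE cVH cΛ cE₂ cB (c • wsym22 M) vh₂S (mixFFAt (toSite r) Lc) (0 + 1))) a b (Sum.inl b) (Sum.inl a) + zmode Lc (unitS₂ (sfStep Lc (0 + 1)) (smStep 3 Lc (0 + 1)) (T2RecAt 3 Lc (toSite r) cE cVH cΛ cE₂ cB (c • wsym22 M) vh₂S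 (mixFFAt (toSite r) Lc) (0 + 1))) b a (Sum.inl b) (Sum.inl a))
      = 2 * (Lc : ℝ) ^ 12 := by
  have hMr : (M : ℝ) ≠ 0 := Nat.cast_ne_zero.mpr hM
  rw [crossed_zmode_memberOne hLc hr cVH cΛ cB c M hcE hcE₂ hBff hBmm hB hBt hab, hc]
  field_simp
  ring

/-- NOT IN PRINT; OUR BOOKKEEPING.  **AND IT EQUALS THE LEVEL-`0` VALUE** (`M ≠ 0`, `c = (8M²)⁻¹`; any `Lc ≥ 1`): `X(zmode_Lc U_1)(a,b) = X(zmode_Lc U_0)(a,b)` — the first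
step of the crossed ledger, a TREE THEOREM at the END probes' pins. -/
theorem crossed_zmode_memberOne_eq_memberZero_pin (hLc : 1 ≤ Lc) (hr : r ∈ box (3 + 1) Lc) {cE cE₂ : ℝ} (cVH cΛ cB : ℝ) (c : ℝ) (M : ℕ)
    (hcE : cE = (Lc : ℝ) ^ (3 + 1)) (hcE₂ : cE₂ = (Lc : ℝ) ^ (2 * (3 + 1)))
    {vh₂S : Tab 3} (hBff : ∀ κ u κ' u' x z (α β : Fin (3 + 1)), vh₂S κ u κ' u' x z (Sum.inl α) (Sum.inl β) = 0)
    (hBmm : ∀ κ u κ' u' x z (μ ν : Fin (3 + 1)), vh₂S κ u κ' u' x z (Sum.inr μ) (Sum.inr ν) = 0)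
    (hB : ∃ C δ : ℝ, 0 < δ ∧ LocStencil₂ vh₂S C δ)
    (hBt : ∀ (κ : Fin (3 + 1)) (u : Fin (3 + 1) → ℤ) (κ' : Fin (3 + 1)) (u' t : Fin (3 + 1) → ℤ),
      vh₂S κ (u + (Lc : ℤ) • t) κ' (u' + (Lc : ℤ) • t) = shiftK (-((Lc : ℤ) • t)) (vh₂S κ u κ' u'))
    {a b : Fin (3 + 1)} (hab : a ≠ b) (hM : M ≠ 0) (hc : c = (8 * (M : ℝ) ^ 2)⁻¹) :
    zmode Lc (unitS₂ (sfStep Lc (0 + 1)) (smStep 3 Lc (0 + 1)) (T2RecAt 3 Lc (toSite r) cE cVH cΛ cE₂ cB (c • wsym22 M) vh₂S (mixFFAt (toSite r) Lc) (0 + 1))) a b (Sum.inl a) (Sum.inl b) + zmode Lc (unitS₂ (sfStep Lc (0 + 1)) (smStep 3 Lc (0 + 1)) (T2RecAt 3 Lc (toSite r) cE cVH cΛ cE₂ cB (c • wsym22 M) vh₂S (mixFFAt (toSite r) Lc) (0 + 1))) b a (Sum.inl a) (Sum.inl b) + (zmode Lc (unitS₂ (sfStep Lc (0 + 1)) (smStep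 3 Lc (0 + 1)) (T2RecAt 3 Lc (toSite r) cE cVH cΛ cE₂ cB (c • wsym22 M) vh₂S (mixFFAt (toSite r) Lc) (0 + 1))) a b (Sum.inl b) (Sum.inl a) + zmode Lc (unitS₂ (sfStep Lc (0 + 1)) (smStep 3 Lc (0 + 1)) (T2RecAt 3 Lc (toSite r) cE cVH cΛ cE₂ cB (c • wsym22 M) vh₂S (mixFFAt (toSite r) Lc) (0 + 1))) b a (Sum.inl b) (Sum.inl a))
      = zmode Lc (unitS₂ (sfStep Lc 0) (smStep 3 Lc 0) (T2RecAt 3 Lc (toSite r) cE cVH cΛ cE₂ cB (c • wsym22 M) vh₂S (mixFFAt (toSite r) Lc) 0)) a b (Sum.inl a) (Sum.inl b) + zmode Lc (unitS₂ (sfStep Lc 0) (smStep 3 Lc 0) (T2RecAt 3 Lc (toSite r) cE cVH cΛ cE₂ cB (c • wsym22 M) vh₂S (mixFFAt (toSite r) Lc) 0)) b a (Sum.inl a) (Sum.inl b) + (zmode Lc (unitS₂ (sfStep Lc 0) (smStep 3 Lc 0) (T2RecAt 3 Lc (toSite r) cE cVH cΛ cE₂ cB (c • wsym22 M) vh₂S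 (mixFFAt (toSite r) Lc) 0)) a b (Sum.inl b) (Sum.inl a) + zmode Lc (unitS₂ (sfStep Lc 0) (smStep 3 Lc 0) (T2RecAt 3 Lc (toSite r) cE cVH cΛ cE₂ cB (c • wsym22 M) vh₂S (mixFFAt (toSite r) Lc) 0)) b a (Sum.inl b) (Sum.inl a)) := by
  have hMr : (M : ℝ) ≠ 0 := Nat.cast_ne_zero.mpr hM
  rw [crossed_zmode_memberOne_pin hLc hr cVH cΛ cB c M hcE hcE₂ hBff hBmm hB hBt hab hM hc,
    crossed_zmode_memberZero (Lc := Lc) Lc cE cVH cΛ cE₂ cB c M (toSite r) (mixFF := mixFFAt (toSite r) Lc) hBff hab, hcE₂, hc]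
  field_simp
  ring

/-- NOT IN PRINT; OUR BOOKKEEPING.  **THE SAME WITH THE LEVEL SPELLED `1`** (for consumers that index the member by a literal level; `simp only [Nat.zero_add]` on
`crossed_zmode_memberOne_eq_memberZero_pin`): at `c = (8M²)⁻¹`, `M ≠ 0`, `X(zmode_Lc U_1)(a,b) = X(zmode_Lc U_0)(a,b)`. -/
theorem crossed_zmode_memberOne_eq_memberZero_pin' (hLc : 1 ≤ Lc) (hr : r ∈ box (3 + 1) Lc) {cE cE₂ : ℝ} (cVH cΛ cB : ℝ) (c : ℝ) (M : ℕ)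
    (hcE : cE = (Lc : ℝ) ^ (3 + 1)) (hcE₂ : cE₂ = (Lc : ℝ) ^ (2 * (3 + 1)))
    {vh₂S : Tab 3} (hBff : ∀ κ u κ' u' x z (α β : Fin (3 + 1)), vh₂S κ u κ' u' x z (Sum.inl α) (Sum.inl β) = 0)
    (hBmm : ∀ κ u κ' u' x z (μ ν : Fin (3 + 1)), vh₂S κ u κ' u' x z (Sum.inr μ) (Sum.inr ν) = 0)
    (hB : ∃ C δ : ℝ, 0 < δ ∧ LocStencil₂ vh₂S C δ)
    (hBt : ∀ (κ : Fin (3 + 1)) (u : Fin (3 + 1) → ℤ) (κ' : Fin (3 + 1)) (u' t : Fin (3 + 1) → ℤ),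
      vh₂S κ (u + (Lc : ℤ) • t) κ' (u' + (Lc : ℤ) • t) = shiftK (-((Lc : ℤ) • t)) (vh₂S κ u κ' u'))
    {a b : Fin (3 + 1)} (hab : a ≠ b) (hM : M ≠ 0) (hc : c = (8 * (M : ℝ) ^ 2)⁻¹) :
    zmode Lc (unitS₂ (sfStep Lc 1) (smStep 3 Lc 1) (T2RecAt 3 Lc (toSite r) cE cVH cΛ cE₂ cB (c • wsym22 M) vh₂S (mixFFAt (toSite r) Lc) 1)) a b (Sum.inl a) (Sum.inl b) + zmode Lc (unitS₂ (sfStep Lc 1) (smStep 3 Lc 1) (T2RecAt 3 Lc (toSite r) cE cVH cΛ cE₂ cB (c • wsym22 M) vh₂S (mixFFAt (toSite r) Lc) 1)) b a (Sum.inl a) (Sum.inl b) + (zmode Lc (unitS₂ (sfStep Lc 1) (smStep 3 Lc 1) (T2RecAt 3 Lc (toSite r) cE cVH cΛ cE₂ cB (c • wsym22 M) vh₂S (mixFFAt (toSite r) Lc) 1)) a b (Sum.inl b) (Sum.inl a) + zmode Lc (unitS₂ (sfStep Lc 1) (smStep 3 Lc 1) (T2RecAt 3 Lc (toSite r) cE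 cVH cΛ cE₂ cB (c • wsym22 M) vh₂S (mixFFAt (toSite r) Lc) 1)) b a (Sum.inl b) (Sum.inl a))
      = zmode Lc (unitS₂ (sfStep Lc 0) (smStep 3 Lc 0) (T2RecAt 3 Lc (toSite r) cE cVH cΛ cE₂ cB (c • wsym22 M) vh₂S (mixFFAt (toSite r) Lc) 0)) a b (Sum.inl a) (Sum.inl b) + zmode Lc (unitS₂ (sfStep Lc 0) (smStep 3 Lc 0) (T2RecAt 3 Lc (toSite r) cE cVH cΛ cE₂ cB (c • wsym22 M) vh₂S (mixFFAt (toSite r) Lc) 0)) b a (Sum.inl a) (Sum.inl b) + (zmode Lc (unitS₂ (sfStep Lc 0) (smStep 3 Lc 0) (T2RecAt 3 Lc (toSite r) cE cVH cΛ cE₂ cB (c • wsym22 M) vh₂S (mixFFAt (toSite r) Lc) 0)) a b (Sum.inl b) (Sum.inl a) + zmode Lc (unitS₂ (sfStep Lc 0) (smStep 3 Lc 0) (T2RecAt 3 Lc (toSite r) cE cVH cΛ cE₂ cB (c • wsym22 M) vh₂S (mixFFAt (toSite r) Lc) 0)) b a (Sum.inl b) (Sum.inl a)) := by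
  have h := crossed_zmode_memberOne_eq_memberZero_pin hLc hr cVH cΛ cB c M hcE hcE₂ hBff hBmm hB hBt hab hM hc
  simp only [Nat.zero_add] at h
  exact h

end Summit.QuantumFields.BalabanUV.Beta.GAN24.CrossedLedgerFirstStep

end
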